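import Mathlib
import Summits.ResolutionOfSingularities.ResolutionOfSingularities.Theorems.HomologicalConductorPersistenceCyclicQuotientCompletionSatFourMinimal
import Summits.ResolutionOfSingularities.ResolutionOfSingularities.Theorems.HomologicalConductorPersistenceSurfaceSaturationResidualFourGorenstein
import Summits.ResolutionOfSingularities.ResolutionOfSingularities.Theorems.HomologicalConductorPersistencePeriodicSaturationStage
import Summits.ResolutionOfSingularities.ResolutionOfSingularities.Theorems.HomologicalConductorNoZenoIffKernel
import Summits.ResolutionOfSingularities.ResolutionOfSingularities.Theorems.HomologicalConductorNoZenoTowerNoetherian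
import Summits.ResolutionOfSingularities.ResolutionOfSingularities.Theorems.SyzygyFlatteningHigherRankTerminationLocAt
import HarnessLib

/-!
# Rung S-2 `PersistenceSurface` (stmt-ResolutionOfSingularities-19970), stub C1 (`Sat₄`) — the fourth residual WITH THE
# ANALYTICALLY-TORIC EXEMPTION (route vocabulary)

[OURS · cell decomp-res · rung S-2; seat leafhand-res-homologicalconduct-17 gen 0]  Nothing here is a statement of the
manuscript under review (Hironaka 2017); AI-written, weaker than expert review.  DEF-FREE.

The hypothesis-minimal toric `Sat₄` theorem (`…CyclicQuotientCompletionSatFourMinimal`, this seat: a noetherian local `T`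
whose completion is a domain ring-isomorphic to the completion of a localisation of `U = k₀[u,v]^{(n;1,q)}` at its vertex
has `ca(T) ⊆ ca⁴(T)`) is put into the ROUTE'S currency, exactly as the Gorenstein exemption of
`…SaturationResidualFourGorenstein`: (1) for a subalgebra stage `T ⊆ K` of the tower, `ca T ⊆ caAt 4 T` (the `m`-th
conjunct of `SaturationFourSurfaceResidual₄`) as soon as `T` is ANALYTICALLY TORIC — `T̂` a domain and `T̂ ≃+* Ŝ` for
some cyclic-quotient vertex localisation `S` over ANY field `k₀` (not necessarily the route's `k`); (2) the registered
stub `SaturationFourSurfaceResidual₄` follows from `Sat₄` demanded ONLY at the residual stages that are NOT analytically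
toric (stated def-free as a disjunction per stage).  So the open cell of stub C1 shrinks to: presented normal stages of
embedding dimension `≥ 4` that are not analytically toric (non-rational Σ6; rational non-toric), the non-normal stage `0`,
and — for the toric ones — the side fact «`T̂` is a domain» (analytic irreducibility).

* `isLocalRing_tower` — every stage `↥(tower O A m)` is a local ring (packaged; was inline in `…CaPrincipalReduction`);
* `ca_subset_caAt_four_of_analyticallyToric` — (1);
* `saturationFourSurfaceResidual₄_of_toric_exemption` — (2).

References: S. B. Iyengar, R. Takahashi, IMRN 2016, Def. 2.1 [`IyengarTakahashi2014`]; A. Bahlekeh, E. Hakimian, S. Salarian,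
R. Takahashi, Q. J. Math. 67 (2016), Thm. 4.5 [`BahlekehHakimianSalarianTakahashi2015`] — through landed tree lemmas only.
-/

-- single-problem summit: the doubled namespace component `ResolutionOfSingularities` is forced
set_option linter.dupNamespace false

noncomputable section

open IsLocalRing MvPolynomial Literature.RingTheory.CohomologyAnnihilator
open Summit.ResolutionOfSingularities.ResolutionOfSingularities.Theorems
open Summit.ResolutionOfSingularities.ResolutionOfSingularities.Theorems.NoZeno.Birth
open Summit.ResolutionOfSingularities.ResolutionOfSingularities.Theorems.HomologicalConductor.PersistenceSurfaceSaturationResidual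
open Summit.ResolutionOfSingularities.ResolutionOfSingularities.Theorems.HomologicalConductor.PersistenceSurfaceSaturationResidualThree
open Summit.ResolutionOfSingularities.ResolutionOfSingularities.Theorems.HomologicalConductor.PersistenceSurfaceSaturationResidualFour
open Summit.ResolutionOfSingularities.ResolutionOfSingularities.Theorems.HomologicalConductor.PeriodicSaturationStage
  (ca_subset_caAt_of_le)
open Summit.ResolutionOfSingularities.ResolutionOfSingularities.Theorems.HomologicalConductor.PersistenceCyclicQuotientVertexIsolated
  (X_pow_mem)
open Summit.ResolutionOfSingularities.ResolutionOfSingularities.Theorems.HomologicalConductor.PersistenceCyclicQuotientCompletionSatFourMinimal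
  (cohomologyAnnihilator_le_caAt_four_of_ringEquiv_completion_vertex')

universe u

namespace Summit.ResolutionOfSingularities.ResolutionOfSingularities.Theorems.HomologicalConductor.PersistenceSurfaceSaturationResidualFourToric

/-! ## Stages are local -/

/-- **Every stage of the `ca`-tower is a local ring**: `tower O A m = loc O B = locAt O B` for some `B ⊆ O`
(`exists_tower_eq_loc`, `loc_eq_locAt`), and `locAt O B` is local (`SyzygyFlattening.isLocalRing_locAt`). [folklore] -/
theorem isLocalRing_tower {k K : Type} [Field k] [Field K] [Algebra k K] (O : ValuationSubring K) (A : Subalgebra k K)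
    (hk : ∀ c : k, algebraMap k K c ∈ O) (hAO : A.toSubring ≤ O.toSubring) (m : ℕ) : IsLocalRing ↥(tower O A m) := by
  obtain ⟨B, hBO, hTB⟩ := exists_tower_eq_loc O A hk hAO m
  rw [hTB, loc_eq_locAt]
  exact SyzygyFlattening.isLocalRing_locAt O B hBO

/-! ## (1) `Sat₄` at an analytically-toric subalgebra stage, route vocabulary -/

/-- **`ca T ⊆ caAt 4 T` at an analytically-toric stage** (route vocabulary, universe-polymorphic; the route takes `u = 0`):
`T ⊆ K` a subalgebra which is noetherian local with `T̂` a domain, `U = k₀[u,v]^{(n;1,q)}` (`gcd(q,n) = 1`, `k₀` any field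
in the same universe), `𝔪 ∋ uⁿ, vⁿ` its vertex, `S` a noetherian local localisation of `U` at `𝔪`, `e : T̂ ≃+* Ŝ`.
[OURS · cell decomp-res] -/
theorem ca_subset_caAt_four_of_analyticallyToric {k K : Type u} [Field k] [Field K] [Algebra k K] (T : Subalgebra k K)
    [IsNoetherianRing ↥T] [IsLocalRing ↥T] [IsDomain (AdicCompletion (maximalIdeal ↥T) ↥T)]
    {k₀ : Type u} [Field k₀] {n : ℕ} [NeZero n] {q : ℕ} (U : Subalgebra k₀ (MvPolynomial (Fin 2) k₀))
    (hU : ∀ p, p ∈ U ↔ weightedHomogeneousComponent (![1, (q : ZMod n)] : Fin 2 → ZMod n) 0 p = p)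
    (hq : q.Coprime n) (𝔪 : Ideal U) [𝔪.IsMaximal]
    (hu : (⟨(X 0 : MvPolynomial (Fin 2) k₀) ^ n, X_pow_mem U hU 0⟩ : U) ∈ 𝔪)
    (hv : (⟨(X 1 : MvPolynomial (Fin 2) k₀) ^ n, X_pow_mem U hU 1⟩ : U) ∈ 𝔪)
    (S : Type u) [CommRing S] [Algebra U S] [IsLocalization.AtPrime S 𝔪] [IsNoetherianRing S] [IsLocalRing S]
    (e : AdicCompletion (maximalIdeal ↥T) ↥T ≃+* AdicCompletion (maximalIdeal S) S) :
    {x : K | ∃ hx : x ∈ T, ∃ m : ℕ, ∀ i : ℕ, m ≤ i → ∀ (M N : ModuleCat.{u} ↥T),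
        Module.Finite ↥T M → Module.Finite ↥T N →
          ∀ e : CategoryTheory.Abelian.Ext.{u} M N i, (⟨x, hx⟩ : ↥T) • e = 0} ⊆
      {x : K | ∃ hx : x ∈ T, ∀ i : ℕ, 4 ≤ i → ∀ (M N : ModuleCat.{u} ↥T),
        Module.Finite ↥T M → Module.Finite ↥T N →
          ∀ e : CategoryTheory.Abelian.Ext.{u} M N i, (⟨x, hx⟩ : ↥T) • e = 0} :=
  ca_subset_caAt_of_le T (cohomologyAnnihilator_le_caAt_four_of_ringEquiv_completion_vertex' U hU hq 𝔪 hu hv S e)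

/-! ## (2) The fourth residual with the analytically-toric exemption -/

/-- **`SaturationFourSurfaceResidual₄` WITH THE ANALYTICALLY-TORIC EXEMPTION.**  The registered stub follows if, at every
residual stage `T = ↥(tower O A m)` (not regular, not a monic-hypersurface localisation, not an edim-candidate, singular
successor, Krull dimension `2`), EITHER `T` is analytically toric — `T̂` is a domain and `T̂ ≃+* Ŝ` for a noetherian local
localisation `S` at the vertex of some `U = k₀[u,v]^{(n;1,q)}`, `gcd(q,n) = 1`, `k₀ : Type` any field — OR `ca T ⊆ caAt 4 T`
holds.  (Def-free phrasing of «`Sat₄` is demanded only off the analytically-toric class».) [OURS · cell decomp-res] -/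
theorem saturationFourSurfaceResidual₄_of_toric_exemption
    (h : ∀ p : ℕ, p.Prime → ∀ (k K : Type) [Field k] [CharP k p] [Field K] [Algebra k K]
      (O : ValuationSubring K) (A : Subalgebra k K), (∀ c : k, algebraMap k K c ∈ O) → A.FG →
      IsFractionRing ↥A K → A.toSubring ≤ O.toSubring → ringKrullDim ↥A ≤ 2 → ∀ m : ℕ,
      ¬ IsRegularLocalRing ↥(tower O A m) → ¬ IsMonicHypersurfaceLocalization k 2 ↥(tower O A m) →
      ¬ IsEdimHypersurfaceCandidate 2 ↥(tower O A m) → ¬ IsRegularLocalRing ↥(tower O A (m + 1)) →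
      ringKrullDim ↥(tower O A m) = (2 : ℕ) →
      (∀ [IsLocalRing ↥(tower O A m)],
        IsDomain (AdicCompletion (maximalIdeal ↥(tower O A m)) ↥(tower O A m)) ∧
        ∃ (k₀ : Type) (_ : Field k₀) (n : ℕ) (_ : NeZero n) (q : ℕ) (U : Subalgebra k₀ (MvPolynomial (Fin 2) k₀))
          (hU : ∀ p, p ∈ U ↔ weightedHomogeneousComponent (![1, (q : ZMod n)] : Fin 2 → ZMod n) 0 p = p)
          (_ : q.Coprime n) (𝔪 : Ideal U) (_ : 𝔪.IsMaximal)
          (_ : (⟨(X 0 : MvPolynomial (Fin 2) k₀) ^ n, X_pow_mem U hU 0⟩ : U) ∈ 𝔪)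
          (_ : (⟨(X 1 : MvPolynomial (Fin 2) k₀) ^ n, X_pow_mem U hU 1⟩ : U) ∈ 𝔪)
          (S : Type) (_ : CommRing S) (_ : Algebra U S) (_ : IsLocalization.AtPrime S 𝔪) (_ : IsNoetherianRing S)
          (_ : IsLocalRing S),
          Nonempty (AdicCompletion (maximalIdeal ↥(tower O A m)) ↥(tower O A m) ≃+* AdicCompletion (maximalIdeal S) S)) ∨
      {x : K | ∃ hx : x ∈ tower O A m, ∃ n : ℕ, ∀ i : ℕ, n ≤ i → ∀ (M N : ModuleCat.{0} ↥(tower O A m)),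
          Module.Finite ↥(tower O A m) M → Module.Finite ↥(tower O A m) N →
            ∀ e : CategoryTheory.Abelian.Ext.{0} M N i, (⟨x, hx⟩ : ↥(tower O A m)) • e = 0} ⊆
        {x : K | ∃ hx : x ∈ tower O A m, ∀ i : ℕ, 4 ≤ i → ∀ (M N : ModuleCat.{0} ↥(tower O A m)),
          Module.Finite ↥(tower O A m) M → Module.Finite ↥(tower O A m) N →
            ∀ e : CategoryTheory.Abelian.Ext.{0} M N i, (⟨x, hx⟩ : ↥(tower O A m)) • e = 0}) :
    SaturationFourSurfaceResidual₄ := by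
  intro p hp k K _ _ _ _ O A hk hA hfr hAO hdim caAt ca loc chart nrm tower' m hreg hmon hcand hsucc hdim2
  show NoZeno.Birth.ca (NoZeno.Birth.tower O A m) ⊆ _
  haveI : IsNoetherianRing ↥(tower O A m) := stub_towerNoetherian k K O A hk hA hfr hAO m
  haveI : IsLocalRing ↥(tower O A m) := isLocalRing_tower O A hk hAO m
  rcases h p hp k K O A hk hA hfr hAO hdim m hreg hmon hcand hsucc hdim2 with htor | hsat
  · obtain ⟨hdom, k₀, _, n, _, q, U, hU, hq, 𝔪, _, hu, hv, S, _, _, _, _, _, ⟨e⟩⟩ := htor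
    haveI := hdom
    exact ca_subset_caAt_four_of_analyticallyToric (tower O A m) U hU hq 𝔪 hu hv S e
  · exact hsat

end Summit.ResolutionOfSingularities.ResolutionOfSingularities.Theorems.HomologicalConductor.PersistenceSurfaceSaturationResidualFourToric

end
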